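import Summits.HubbardSuperconductivity.HubbardSuperconductivity.Theorems.AnisotropyChordTransferFibre3RowCXSWindowLemmas

/-!
# Route `AnisotropyChord` / H0 rotor rung, row C (KT-2b): the WINDOW majorant of the summand of `XSn` — assembly

Continuation of `…RowCXSWindowLemmas`: ★ `sN_window_le` — for an integer point `p` with `p, p − x̂ ∈ zWindow K` (`4K ≤ L`),
`θ² ≤ T ≤ 1`, `ν₁ ≤ ν ≤ ν₂ < 4/π²` and positive window denominators, `s(toTor p) ≤ sHiR T ν₁ ν₂ p`, assembled from the
exact form `sN_eq`, the factor brackets `Xf_bracket`, the sign/size of `d` (`d_sign_bracket`: `d = ±D`,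
`D = 4 sin(θm/2) sin(θ/2)/θ² ∈ [dlo, m]`), the `a_y` bracket (`aylo_le_ay`) and the four term inequalities.
Prover seat `hubbard-h0-rotor-p1` g28 (route lead); helper for piece A = stmt-HubbardSuperconductivity-23918 of rung 19089
(`--supports`, helper class).  WHAT THIS IS NOT: nothing here proves superconductivity in the Hubbard model; a pointwise lemma
for one input of ONE row of ONE conditional reduction; the rotor TARGET as originally worded stays FALSE (g15 verdict).
Tree imports only; no sorry, no new axioms.
-/

set_option linter.dupNamespace false
set_option autoImplicit false

noncomputable section

open scoped BigOperators
open Complex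

namespace Summit.HubbardSuperconductivity.HubbardSuperconductivity.Theorems.AnisotropyChord.Transfer.Fibre3

namespace RowC

open B1

variable (L : ℕ) [NeZero L]

/-! ## The `a_y` and `d` brackets at integer window points -/

/-- the `a_y` lower bracket at an integer window point. [folklore] -/
theorem aylo_le_ay (K : ℕ) (h4K : 4 * K ≤ L) (T : ℝ) (hT : (2 * Real.pi / L) ^ 2 ≤ T) (p : ℤ × ℤ)
    (hp : p ∈ zWindow K) : ayloR T p ≤ ay L (toTor L p) := by
  have hLpos : (0 : ℝ) < L := by exact_mod_cast Nat.pos_of_ne_zero (NeZero.ne L)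
  set θ : ℝ := 2 * Real.pi / L with hθdef
  have hθ : 0 < θ := by positivity
  have hθ2 : 0 < θ ^ 2 := by positivity
  have hθK : θ * K ≤ Real.pi / 2 := theta_mul_le L K h4K
  obtain ⟨_, hp2abs⟩ := abs_intCast_le_of_mem_zWindow K p hp
  rw [ay_toTor]
  unfold ayloR
  rw [← hθdef]
  have hp2 : |θ * ((p.2 : ℤ) : ℝ)| ≤ Real.pi := by
    rw [abs_mul, abs_of_pos hθ]
    calc θ * |((p.2 : ℤ) : ℝ)| ≤ θ * K := mul_le_mul_of_nonneg_left hp2abs hθ.le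
      _ ≤ Real.pi / 2 := hθK
      _ ≤ Real.pi := by linarith [Real.pi_pos]
  have hq := sq_sub_quartic_le (θ * ((p.2 : ℤ) : ℝ)) hp2
  rw [le_div_iff₀ hθ2]
  have hp4 : 0 ≤ ((p.2 : ℤ) : ℝ) ^ 2 * ((p.2 : ℤ) : ℝ) ^ 2 * θ ^ 2 := by positivity
  have h1' : θ ^ 2 * (((p.2 : ℤ) : ℝ) ^ 2 * ((p.2 : ℤ) : ℝ) ^ 2 * θ ^ 2)
      ≤ T * (((p.2 : ℤ) : ℝ) ^ 2 * ((p.2 : ℤ) : ℝ) ^ 2 * θ ^ 2) := mul_le_mul_of_nonneg_right hT hp4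
  have e1 : (θ * ((p.2 : ℤ) : ℝ)) ^ 2 - (θ * ((p.2 : ℤ) : ℝ)) ^ 4 / 12
      = ((p.2 : ℤ) : ℝ) ^ 2 * θ ^ 2 - θ ^ 2 * (((p.2 : ℤ) : ℝ) ^ 2 * ((p.2 : ℤ) : ℝ) ^ 2 * θ ^ 2) / 12 := by ring
  have e2 : ((p.2 : ℤ) : ℝ) ^ 2 * (1 - T * ((p.2 : ℤ) : ℝ) ^ 2 / 12) * θ ^ 2
      = ((p.2 : ℤ) : ℝ) ^ 2 * θ ^ 2 - T * (((p.2 : ℤ) : ℝ) ^ 2 * ((p.2 : ℤ) : ℝ) ^ 2 * θ ^ 2) / 12 := by ring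
  rw [e2]
  rw [e1] at hq
  linarith

/-- `d` at an integer window point as `±D`, `D = 4 sin(θm/2) sin(θ/2)/θ²`, `m = |2p₁ − 1|`, with the bracket of `D`. [folklore] -/
theorem d_sign_bracket (K : ℕ) (h4K : 4 * K ≤ L) (T : ℝ) (hT : (2 * Real.pi / L) ^ 2 ≤ T) (hT1 : T ≤ 1)
    (p : ℤ × ℤ) (hp : p ∈ zWindow K) :
    ∃ D : ℝ, 0 ≤ D ∧ dloR T p ≤ D ∧ D ≤ mR p ∧
      (1 ≤ p.1 → ax L (toTor L p) - ax L (toTor L p - K1 L) = D) ∧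
      (¬ 1 ≤ p.1 → ax L (toTor L p) - ax L (toTor L p - K1 L) = -D) := by
  have hLpos : (0 : ℝ) < L := by exact_mod_cast Nat.pos_of_ne_zero (NeZero.ne L)
  set θ : ℝ := 2 * Real.pi / L with hθdef
  have hθ : 0 < θ := by positivity
  have hθK : θ * K ≤ Real.pi / 2 := theta_mul_le L K h4K
  have hθ1 : θ ≤ 1 := by
    have : θ ^ 2 ≤ 1 := hT.trans hT1
    nlinarith
  obtain ⟨hp1abs, _⟩ := abs_intCast_le_of_mem_zWindow K p hp
  set m : ℝ := mR p with hmdef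
  have hm0 : 0 ≤ m := by rw [hmdef]; unfold mR; exact abs_nonneg _
  have hm_le : m ≤ 2 * K + 1 := by
    rw [hmdef]; unfold mR
    obtain ⟨ha, hb⟩ := abs_le.1 hp1abs
    rw [abs_le]; constructor <;> linarith
  have hmθ : (θ * (m / 2)) ^ 2 ≤ 6 := by
    have hθm : θ * (m / 2) ≤ Real.pi / 2 + θ / 2 := by
      have : θ * (m / 2) ≤ θ * ((2 * K + 1) / 2) := mul_le_mul_of_nonneg_left (by linarith) hθ.le
      have e : θ * ((2 * (K : ℝ) + 1) / 2) = θ * K + θ / 2 := by ring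
      linarith
    have hup : θ * (m / 2) ≤ 2.1 := by have := Real.pi_lt_d2; linarith
    have hlo : 0 ≤ θ * (m / 2) := by positivity
    nlinarith
  obtain ⟨hDlo, hDhi⟩ := sin_prod_bracket θ T m hθ hT hT1 hm0 hmθ
  refine ⟨4 * Real.sin (θ * (m / 2)) * Real.sin (θ / 2) / θ ^ 2, le_trans (le_max_left _ _) hDlo, ?_, hDhi, ?_, ?_⟩
  · unfold dloR; rw [← hmdef]; exact hDlo
  · intro hp1
    have hm' : m = 2 * ((p.1 : ℤ) : ℝ) - 1 := by
      rw [hmdef]; unfold mR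
      rw [abs_of_nonneg]
      have : (1 : ℝ) ≤ ((p.1 : ℤ) : ℝ) := by exact_mod_cast hp1
      linarith
    rw [d_toTor, ← hθdef, hm']
    congr 3
    ring_nf
  · intro hp1
    have hm' : m = 1 - 2 * ((p.1 : ℤ) : ℝ) := by
      rw [hmdef]; unfold mR
      rw [abs_of_nonpos]
      · ring
      · have : ((p.1 : ℤ) : ℝ) ≤ 0 := by exact_mod_cast (by omega : p.1 ≤ 0)
        linarith
    rw [d_toTor, ← hθdef, hm']
    have e : θ * (((p.1 : ℤ) : ℝ) - 1 / 2) = -(θ * ((1 - 2 * ((p.1 : ℤ) : ℝ)) / 2)) := by ring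
    rw [e, Real.sin_neg]
    ring

/-- ★ THE WINDOW MAJORANT: `s(toTor p) ≤ sHiR T ν₁ ν₂ p` for `p, p − x̂ ∈ zWindow K`. [folklore] -/
theorem sN_window_le (K : ℕ) (h4K : 4 * K ≤ L) (T ν₁ ν₂ ν : ℝ) (hT : (2 * Real.pi / L) ^ 2 ≤ T) (hT1 : T ≤ 1)
    (h1 : ν₁ ≤ ν) (h2 : ν ≤ ν₂) (hν : ν₂ < 4 / Real.pi ^ 2) (p : ℤ × ℤ)
    (hp : p ∈ zWindow K) (hpm : shx p ∈ zWindow K) (hpos : 0 < winT T p - ν₂) (hposm : 0 < winT T (shx p) - ν₂) :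
    sN L ν (toTor L p) ≤ sHiR T ν₁ ν₂ p := by
  have hνν : ν < 4 / Real.pi ^ 2 := lt_of_le_of_lt h2 hν
  -- the two momenta
  set k : Tor L := toTor L p with hkdef
  have hKL : K < L := by
    have hK1 : 1 ≤ K := by
      obtain ⟨hp0, ⟨ha, hb⟩, ⟨hc, hd⟩⟩ := (mem_zWindow_iff K p).1 hp
      by_contra h0
      have hK0 : K = 0 := by omega
      subst hK0
      exact hp0 (Prod.ext (show p.1 = 0 by omega) (show p.2 = 0 by omega))
    omega
  have hk0 : k ≠ 0 := intCast_ne_zero_of_mem_zWindow L K hKL p hp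
  have hkm : toTor L (shx p) ≠ 0 := intCast_ne_zero_of_mem_zWindow L K hKL (shx p) hpm
  have hk1 : k ≠ K1 L := by
    intro h
    apply hkm
    rw [toTor_shx, ← hkdef, h, sub_self]
  -- the brackets of the two factors
  obtain ⟨hGlo, hGhi, hGlo0⟩ := Xf_bracket L K h4K T ν₁ ν₂ ν hT h1 h2 hνν ((0 : ℤ), (0 : ℤ)) k p hp
    (by rw [hkdef, toTor_zero_zero, add_zero]) hpos
  obtain ⟨hGmlo, hGmhi, hGmlo0⟩ := Xf_bracket L K h4K T ν₁ ν₂ ν hT h1 h2 hνν ((-1 : ℤ), (0 : ℤ)) k (shx p) hpm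
    (by rw [hkdef]; unfold shx; rw [← toTor_add]) hposm
  obtain ⟨he0, he1⟩ := ee_nonneg_le_one L
  obtain ⟨D, hD0, hdloD, hDhi, hdpos, hdneg⟩ := d_sign_bracket L K h4K T hT hT1 p hp
  have haylo := aylo_le_ay L K h4K T hT p hp
  rw [← hkdef] at hdpos hdneg haylo
  rw [sN_eq L ν hνν k hk0 hk1]
  set G := Xf L ν ((0 : ℤ), (0 : ℤ)) k with hGdef
  set Gm := Xf L ν ((-1 : ℤ), (0 : ℤ)) k with hGmdef
  set d : ℝ := ax L k - ax L (k - K1 L) with hddef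
  have hG0 : 0 ≤ G := le_trans hGlo0 hGlo
  have hGm0 : 0 ≤ Gm := le_trans hGmlo0 hGmlo
  have hdlo0 : 0 ≤ dloR T p := by unfold dloR; exact le_max_left _ _
  have hm0 : 0 ≤ mR p := by unfold mR; exact abs_nonneg _
  have hd2 : d ^ 2 = D ^ 2 := by
    by_cases hp1 : 1 ≤ p.1
    · rw [hdpos hp1]
    · rw [hdneg hp1]; ring
  -- term A
  have hA : ee L * Gm ^ 2 * (1 - d * G) ≤ GhiR T ν₂ (shx p) ^ 2 * FAR T ν₁ ν₂ p := by
    unfold FAR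
    by_cases hp1 : 1 ≤ p.1
    · rw [if_pos hp1, hdpos hp1]
      exact termA_pos_le (ee L) Gm G D (GhiR T ν₂ (shx p)) (GloR ν₁ p) (dloR T p)
        he0 he1 hGm0 hGmhi hGlo hGlo0 hD0 hdloD
    · rw [if_neg hp1, hdneg hp1]
      exact termA_neg_le (ee L) Gm G D (GhiR T ν₂ (shx p)) (GhiR T ν₂ p) (mR p)
        he1 hGm0 hGmhi hG0 hGhi hD0 hDhi hm0
  -- term B
  have hB : -(d ^ 2 * (ay L k - ν) * G ^ 2 * Gm ^ 2) ≤ FBR T ν₁ ν₂ p := by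
    unfold FBR
    have hay : ayloR T p - ν₂ ≤ ay L k - ν := by linarith
    by_cases hc : 0 ≤ ayloR T p - ν₂
    · rw [if_pos hc]
      exact termB_pos_le (d ^ 2) (dloR T p ^ 2) (ay L k - ν) (ayloR T p - ν₂) (G ^ 2) (Gm ^ 2)
        (GloR ν₁ p ^ 2) (GloR ν₁ (shx p) ^ 2) hc hay (by rw [hd2]; exact pow_le_pow_left₀ hdlo0 hdloD 2)
        (sq_nonneg _) (pow_le_pow_left₀ hGlo0 hGlo 2) (sq_nonneg _) (pow_le_pow_left₀ hGmlo0 hGmlo 2) (sq_nonneg _)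
    · rw [if_neg hc]
      push Not at hc
      have e : mR p ^ 2 * (ν₂ - ayloR T p) * GhiR T ν₂ p ^ 2 * GhiR T ν₂ (shx p) ^ 2
          = mR p ^ 2 * (-(ayloR T p - ν₂)) * GhiR T ν₂ p ^ 2 * GhiR T ν₂ (shx p) ^ 2 := by ring
      rw [e]
      exact termB_neg_le (d ^ 2) (mR p ^ 2) (ay L k - ν) (ayloR T p - ν₂) (G ^ 2) (Gm ^ 2)
        (GhiR T ν₂ p ^ 2) (GhiR T ν₂ (shx p) ^ 2) hc hay (by rw [hd2]; exact pow_le_pow_left₀ hD0 hDhi 2)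
        (sq_nonneg _) (pow_le_pow_left₀ hG0 hGhi 2) (sq_nonneg _) (pow_le_pow_left₀ hGm0 hGmhi 2) (sq_nonneg _)
  unfold sHiR
  linarith [hA, hB]

end RowC

end Summit.HubbardSuperconductivity.HubbardSuperconductivity.Theorems.AnisotropyChord.Transfer.Fibre3

end
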